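import Mathlib
import Summits.KontsevichZagierPeriods.Zeta5Search.FourthOrderTranslate
import Summits.KontsevichZagierPeriods.Zeta5Search.FourthOrderShapeData
import Summits.KontsevichZagierPeriods.Zeta5Search.FourthOrderFrameNorms
import Summits.KontsevichZagierPeriods.Zeta5Search.ThirdOrderNorms
import HarnessLib

/-!
# ζ(5) search — a live class to FOURTH order as ONE frame functional: `(Ω,N)_x ≡ σ_T[H_x Φ_T]` (tools for THEOREM L5)

Cell `pub-zeta5` (HONEST FRAMING: systematic search; no irrationality claim unless certified), typer seat generation 13.
REPORT-gen2-g14 §2 (boxed formula after Lemma Tr): for a pole class `x` whose exponent function dominates the frame type `T = (L, e)`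
at offset `a` (a T-shape), with `E_x + M ≥ 0` and `E_x ≤ −4`, the normalised pieces `Ω_x = W_x/(−p)^{3−M}`, `N_x = V_x/(−p)^{−M}`
satisfy, GIVEN the classwise fourth digits `SecondResidueLaw.FourthDigitW/V` (hypotheses by name):
`‖Ω_x − ŵ[H_x Φ_T]‖ ≤ p⁻⁴` and `‖N_x − v̂[H_x Φ_T] + (−p)^{E+M} ĝ_x p³λ_p ŵ_x‖ ≤ p⁻⁴` (`classFrameW`, `classFrameV`), where
**`H_x = classH := (−p)^{E_x+M} ĝ_x · (Q_x Z_x)(X + a) · P_x`** (`fourthQ`, `centreZ`, `shapePoly`) is ONE polynomial of degree `E_x + M + 3`.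
Chain: digits ⇒ brackets (`FourthOrderBracket`) ⇒ translation (`FourthOrderTranslate`) ⇒ shape theorem (`FourthOrderShape`).
`p`-adic norms of rational numbers; nothing here bears on irrationality.
-/

noncomputable section

open Finset PowerSeries

namespace Summit.KontsevichZagierPeriods.Zeta5Search.SecondOrder

open Summit.KontsevichZagierPeriods.Zeta5Search.WedgeDictionary (pfData)
open Summit.KontsevichZagierPeriods.Zeta5Search.CasoratianValuation (InPolytope)
open Summit.KontsevichZagierPeriods.Zeta5Search.ClusterValuation
open Summit.KontsevichZagierPeriods.Zeta5Search.PadicSeries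
open Summit.KontsevichZagierPeriods.Zeta5Search.CellA (classW padicNorm_p)
open Summit.KontsevichZagierPeriods.Zeta5Search.SecondResidueLaw (phi3Hat cubicHat wHat4 vHat4 lambdaP predW4 predV4
  FourthDigitW FourthDigitV)
open Literature.NumberTheory.Transcendental.BallRivoal (harm)

variable {p : ℕ} [hp : Fact p.Prime]

/-! ## §1 The classwise digits in normalised form -/

section Digits

variable (b : ℕ → ℤ) (hb : InPolytope b) (hp5 : 5 ≤ p) (hwin : (b 0 + 2 : ℤ) < (p : ℤ) ^ 2) {x : ℕ} (hx : x < p)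
include hb hp5 hwin hx

/-- **(W4) normalised**: `‖W_x/(−p)^{E+3} − ĝ_x·(ŵ − pφŵ₂ + p²cŵ₃ − p³c₃ŵ₄)‖ ≤ p⁻⁴`. -/
theorem deep4W_norm (hW4 : FourthDigitW) (hpole : 1 ≤ classPoleCount b p x) :
    padicNorm p (classW b p x / (-(p : ℚ)) ^ (classExp b p x + 3)
      - gHat b p x * (wHat b p x - (p : ℚ) * phiHat b p x * wHat2 b p x + (p : ℚ) ^ 2 * curvHat b p x * wHat3 b p x
          - (p : ℚ) ^ 3 * cubicHat b p x * wHat4 b p x)) ≤ (p : ℚ) ^ (-(4 : ℤ)) := by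
  have hp' : (-(p : ℚ)) ^ (classExp b p x + 3) ≠ 0 := zpow_ne_zero _ (neg_ne_zero.2 (Nat.cast_ne_zero.2 hp.out.ne_zero))
  have h := padicNorm_le_of_val (p := p) fun hne => hW4 b p x hb hp.out hp5 hwin hx hpole hne
  have e : classW b p x / (-(p : ℚ)) ^ (classExp b p x + 3)
      - gHat b p x * (wHat b p x - (p : ℚ) * phiHat b p x * wHat2 b p x + (p : ℚ) ^ 2 * curvHat b p x * wHat3 b p x
          - (p : ℚ) ^ 3 * cubicHat b p x * wHat4 b p x) =
      ((∑ s ∈ classSet b p x, pfData b 2 s) - predW4 b p x) / (-(p : ℚ)) ^ (classExp b p x + 3) := by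
    unfold classW predW4; field_simp
  rw [e]
  exact norm_div_neg_p_zpow (by rwa [show classExp b p x + 3 + 4 = classExp b p x + 7 by ring])

/-- **(V4) normalised** (`E_x ≤ −4`): `‖V_x/(−p)^E − ĝ_x·(v̂ − pφv̂₂ + p²cv̂₃ − p³c₃v̂₄ − p³λ_pŵ)‖ ≤ p⁻⁴`. -/
theorem deep4V_norm (hV4 : FourthDigitV) (hpole : 1 ≤ classPoleCount b p x) (hE4 : classExp b p x ≤ -4) :
    padicNorm p (classV b p x / (-(p : ℚ)) ^ (classExp b p x)
      - gHat b p x * (vHat b p x - (p : ℚ) * phiHat b p x * vHat2 b p x + (p : ℚ) ^ 2 * curvHat b p x * vHat3 b p x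
          - (p : ℚ) ^ 3 * cubicHat b p x * vHat4 b p x - (p : ℚ) ^ 3 * lambdaP p * wHat b p x)) ≤ (p : ℚ) ^ (-(4 : ℤ)) := by
  have hp' : (-(p : ℚ)) ^ (classExp b p x) ≠ 0 := zpow_ne_zero _ (neg_ne_zero.2 (Nat.cast_ne_zero.2 hp.out.ne_zero))
  have h := padicNorm_le_of_val (p := p) fun hne => hV4 b p x hb hp.out hp5 hwin hx hpole hE4 hne
  have e : classV b p x / (-(p : ℚ)) ^ (classExp b p x)
      - gHat b p x * (vHat b p x - (p : ℚ) * phiHat b p x * vHat2 b p x + (p : ℚ) ^ 2 * curvHat b p x * vHat3 b p x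
          - (p : ℚ) ^ 3 * cubicHat b p x * vHat4 b p x - (p : ℚ) ^ 3 * lambdaP p * wHat b p x) =
      (classV b p x - predV4 b p x) / (-(p : ℚ)) ^ (classExp b p x) := by
    unfold predV4; field_simp
  rw [e]
  exact norm_div_neg_p_zpow h

end Digits

/-! ## §2 The class polynomial `H_x` and the frame form of `(Ω,N)_x` -/

/-- **The class polynomial** `H_x := (−p)^{E_x+M} ĝ_x · (Q_x·Z_x)(X + a) · P_x` (frame coordinates). -/
def classH (b : ℕ → ℤ) (p x M L a : ℕ) (e : ℕ → ℤ) : Polynomial ℚ :=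
  Polynomial.C ((-(p : ℚ)) ^ (classExp b p x + M) * gHat b p x) *
    ((fourthQ b p x * centreZ b p x (topLevel b p x)).comp (Polynomial.X + Polynomial.C (a : ℚ)) *
      shapePoly L a (topLevel b p x) e (fun k => netExp b (x + k * p)))

omit hp in
/-- `deg Q_x ≤ 3`. -/
theorem natDegree_fourthQ_le (b : ℕ → ℤ) (p x : ℕ) : (fourthQ b p x).natDegree ≤ 3 := by
  unfold fourthQ
  have h0 : (1 : Polynomial ℚ).natDegree ≤ 3 := by simp
  have h1 : (Polynomial.C ((p : ℚ) * phiHat b p x) * Polynomial.X).natDegree ≤ 3 :=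
    (Polynomial.natDegree_C_mul_le _ _).trans (by simp)
  have h2 : (Polynomial.C ((p : ℚ) ^ 2 * curvHat b p x) * Polynomial.X ^ 2).natDegree ≤ 3 :=
    (Polynomial.natDegree_C_mul_le _ _).trans (by simp)
  have h3 : (Polynomial.C ((p : ℚ) ^ 3 * cubicHat b p x) * Polynomial.X ^ 3).natDegree ≤ 3 :=
    (Polynomial.natDegree_C_mul_le _ _).trans (by simp)
  exact (Polynomial.natDegree_sub_le _ _).trans (max_le ((Polynomial.natDegree_add_le _ _).trans
    (max_le ((Polynomial.natDegree_sub_le _ _).trans (max_le h0 h1)) h2)) h3)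

section Frame

variable (b : ℕ → ℤ) (hb : InPolytope b) (hp5 : 5 ≤ p) (hwin : (b 0 + 2 : ℤ) < (p : ℤ) ^ 2) {x : ℕ} (hx : x < p)
  (hxn : x ≤ (b 0).toNat) {M L a : ℕ} {e : ℕ → ℤ}
  (hdom : Dominates L e (topLevel b p x) (fun k => netExp b (x + k * p)) a)
include hb hp5 hwin hx hxn hdom

/-- **`Ω_x ≡ ŵ[H_x Φ_T] (mod p⁴)`** (given (W4); `E_x + M ≥ 0`). -/
theorem classFrameW (hW4 : FourthDigitW) (hpole : 1 ≤ classPoleCount b p x) (hEM : 0 ≤ classExp b p x + M) :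
    padicNorm p (classW b p x / (-(p : ℚ)) ^ (-(M : ℤ) + 3) - frameWPoly L e (classH b p x M L a e)) ≤ (p : ℚ) ^ (-(4 : ℤ)) := by
  have hp0 : (p : ℚ) ≠ 0 := Nat.cast_ne_zero.2 hp.out.ne_zero
  have hpneg : (-(p : ℚ)) ≠ 0 := neg_ne_zero.2 hp0
  obtain ⟨hL, hL'⟩ := level_bounds' (p := p) b hxn
  have h := deep4W_norm b hb hp5 hwin hx hW4 hpole
  -- the bracket as a frame functional
  have hbr := bracketW_eq b hb hx hL hL' (fun k => netExp b (x + k * p)) (fun k _ => rfl)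
  have hsh := frameWPoly_shape hdom.le hdom.dom (fourthQ b p x * centreZ b p x (topLevel b p x))
  have hH : frameWPoly L e (classH b p x M L a e) =
      (-(p : ℚ)) ^ (classExp b p x + M) * gHat b p x *
        (wHat b p x - (p : ℚ) * phiHat b p x * wHat2 b p x + (p : ℚ) ^ 2 * curvHat b p x * wHat3 b p x
          - (p : ℚ) ^ 3 * cubicHat b p x * wHat4 b p x) := by
    rw [classH, frameWPoly_C_mul, ← hsh, ← hbr]
  have e1 : classW b p x / (-(p : ℚ)) ^ (-(M : ℤ) + 3) - frameWPoly L e (classH b p x M L a e) =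
      (-(p : ℚ)) ^ (classExp b p x + M) * (classW b p x / (-(p : ℚ)) ^ (classExp b p x + 3)
        - gHat b p x * (wHat b p x - (p : ℚ) * phiHat b p x * wHat2 b p x + (p : ℚ) ^ 2 * curvHat b p x * wHat3 b p x
          - (p : ℚ) ^ 3 * cubicHat b p x * wHat4 b p x)) := by
    have hz : ((-(p : ℚ)) ^ (-(M : ℤ) + 3))⁻¹ = (-(p : ℚ)) ^ (classExp b p x + M) * ((-(p : ℚ)) ^ (classExp b p x + 3))⁻¹ := by
      rw [← zpow_neg, ← zpow_neg, ← zpow_add₀ hpneg]; congr 1; ring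
    rw [hH, div_eq_mul_inv, hz, div_eq_mul_inv]; ring
  rw [e1, padicNorm.mul, LevelClass.padicNorm_neg_p_zpow]
  calc (p : ℚ) ^ (-(classExp b p x + M)) * _ ≤ 1 * (p : ℚ) ^ (-(4 : ℤ)) :=
        mul_le_mul (zpow_le_one_of_nonpos₀ one_le_p (by linarith)) h (padicNorm.nonneg _) zero_le_one
    _ = _ := one_mul _

/-- **`N_x ≡ v̂[H_x Φ_T] − (−p)^{E+M} ĝ_x p³λ_p ŵ_x (mod p⁴)`** (given (V4); `E_x + M ≥ 0`, `E_x ≤ −4`). -/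
theorem classFrameV (hV4 : FourthDigitV) (hpole : 1 ≤ classPoleCount b p x) (hEM : 0 ≤ classExp b p x + M)
    (hE4 : classExp b p x ≤ -4) :
    padicNorm p (classV b p x / (-(p : ℚ)) ^ (-(M : ℤ)) - frameVPoly L e (classH b p x M L a e)
      + (-(p : ℚ)) ^ (classExp b p x + M) * gHat b p x * ((p : ℚ) ^ 3 * lambdaP p * wHat b p x)) ≤ (p : ℚ) ^ (-(4 : ℤ)) := by
  have hp0 : (p : ℚ) ≠ 0 := Nat.cast_ne_zero.2 hp.out.ne_zero
  have hpneg : (-(p : ℚ)) ≠ 0 := neg_ne_zero.2 hp0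
  have hpp : 0 < p := hp.out.pos
  obtain ⟨hL, hL'⟩ := level_bounds' (p := p) b hxn
  have h := deep4V_norm b hb hp5 hwin hx hV4 hpole hE4
  have hbr := bracketV_eq b hb hx hL hL' (fun k => netExp b (x + k * p)) (fun k _ => rfl)
  have hdeg : (fourthQ b p x).natDegree + degN b p x < degD b p x := by
    have h1 := natDegree_fourthQ_le b p x
    have h2 := classExp_eq_degN_sub_degD b p x
    omega
  have htr := frameVPoly_translate b hb hx hL hL' (fun k => netExp b (x + k * p)) (fun k _ => rfl)
    (a := a) (fun k hk hkL => hdom.pos k hkL (Or.inl hk)) (fourthQ b p x) hdeg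
  have hsh := frameVPolySh_shape hdom.le hdom.dom (fourthQ b p x * centreZ b p x (topLevel b p x))
  have hH : frameVPoly L e (classH b p x M L a e) =
      (-(p : ℚ)) ^ (classExp b p x + M) * gHat b p x *
        (vHat b p x - (p : ℚ) * phiHat b p x * vHat2 b p x + (p : ℚ) ^ 2 * curvHat b p x * vHat3 b p x
          - (p : ℚ) ^ 3 * cubicHat b p x * vHat4 b p x) := by
    rw [classH, frameVPoly_C_mul, ← hsh, ← htr, ← hbr]
  have e1 : classV b p x / (-(p : ℚ)) ^ (-(M : ℤ)) - frameVPoly L e (classH b p x M L a e)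
      + (-(p : ℚ)) ^ (classExp b p x + M) * gHat b p x * ((p : ℚ) ^ 3 * lambdaP p * wHat b p x) =
      (-(p : ℚ)) ^ (classExp b p x + M) * (classV b p x / (-(p : ℚ)) ^ (classExp b p x)
        - gHat b p x * (vHat b p x - (p : ℚ) * phiHat b p x * vHat2 b p x + (p : ℚ) ^ 2 * curvHat b p x * vHat3 b p x
          - (p : ℚ) ^ 3 * cubicHat b p x * vHat4 b p x - (p : ℚ) ^ 3 * lambdaP p * wHat b p x)) := by
    have hz : ((-(p : ℚ)) ^ (-(M : ℤ)))⁻¹ = (-(p : ℚ)) ^ (classExp b p x + M) * ((-(p : ℚ)) ^ (classExp b p x))⁻¹ := by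
      rw [← zpow_neg, ← zpow_neg, ← zpow_add₀ hpneg]; congr 1; ring
    rw [hH, div_eq_mul_inv, hz, div_eq_mul_inv]; ring
  rw [e1, padicNorm.mul, LevelClass.padicNorm_neg_p_zpow]
  calc (p : ℚ) ^ (-(classExp b p x + M)) * _ ≤ 1 * (p : ℚ) ^ (-(4 : ℤ)) :=
        mul_le_mul (zpow_le_one_of_nonpos₀ one_le_p (by linarith)) h (padicNorm.nonneg _) zero_le_one
    _ = _ := one_mul _

/-! ### Facts about `H_x` used by the orbit lemma -/

omit hp hb hp5 hwin hx hxn hdom in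
/-- `H_x` as `scalar · G` with `G = (Q_x Z_x)(X+a) · P_x`. -/
theorem classH_eq : classH b p x M L a e = Polynomial.C ((-(p : ℚ)) ^ (classExp b p x + M) * gHat b p x) *
    ((fourthQ b p x * centreZ b p x (topLevel b p x)).comp (Polynomial.X + Polynomial.C (a : ℚ)) *
      shapePoly L a (topLevel b p x) e (fun k => netExp b (x + k * p))) := rfl

end Frame

end Summit.KontsevichZagierPeriods.Zeta5Search.SecondOrder

end
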